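import Mathlib.Algebra.CharP.Defs
import Literature.NumberTheory.GaloisRepresentations.ModPGaloisRep
import Literature.NumberTheory.GaloisRepresentations.RamificationFiltration
import HarnessLib

-- D-0014 sorry-sweep (operator, 2026-08-13): sorried theorems -> named facts `def X : Prop`; partial proofs preserved in comments
-- provenance: harness21/H21/H21/Prelude/GalRep/SerreWeight.lean @ a90de71 (interim HEAD d8f2665); M5 mechanical rewrite
/-!
# Serre's weight `k(ρ̄)` (trunk GalRep, item C16 = `G09:SerreWeight`)

Notion `mod_p_galois_representation` (part 2).  For a two-dimensional mod `p` representation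
`ρ̄_F : Γ_F → GL₂(k)` of a non-archimedean local field `F` (playing the role of `ℚ_p`; the
recipe uses `q = residueFieldCard F`, which is `p` in Serre's setting) we implement Serre's
recipe for the weight `k(ρ̄)`:

* `ModPGaloisRep.IsPeuRamifie ρ̄_F` / `IsTresRamifie ρ̄_F`: *peu / très ramifiée*, defined
  through the upper-numbering filtration `I_F^v = absUpperInertia F v` (item C9): `ρ̄_F` is
  peu ramifiée iff `ρ̄_F(I_F^v) = 1` for all `v > 1`, très ramifiée iff some `I_F^v`, `v > 1`,
  acts non-trivially (equivalently the unique upper ramification jump `> 1` is `1 + 1/(p-1)`,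
  equivalently the Kummer generators of the wild extension are not all units; see the
  docstrings).  This is the upper-numbering characterisation allowed by the outline as THE
  definition.
* `IsLevelTwoWeight`, `IsLevelOneTameWeight`, `IsLevelOneWildWeight`, and their disjunction
  `IsSerreWeight ρ̄_F ι m`: the three cases of Serre's recipe (Duke Math. J. 54 (1987),
  §2.2, §2.3, §2.4), phrased with the inertia shapes `HasLevelTwoInertiaShape`,
  `HasLevelOneInertiaShape`, `IsTamelyRamified` of item C15.
* `serreWeightLocal ρ̄_F ι : ℕ`: the weight, by cases (level two / level one tame / level one
  wild), each case an `sInf` over the admissible normalisations of the exponents (Serre takes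
  the corresponding `min`); junk value `0` if no shape applies.
* `LocalRestrictionAt p ρ̄`: for a global `ρ̄ : ModPGaloisRep ℚ k 2`, a *local restriction
  datum at `p`*: an abstract non-archimedean local field `F` with `[Algebra ℚ F]`, residue field
  of cardinality `p` and `p` a uniformiser (so `F ≅ ℚ_p`), together with
  `ρ̄_F = ρ̄.restrictField F`.  This replaces the missing
  `IsNonarchimedeanLocalField (v.adicCompletion ℚ)` / `ValuativeRel` instances of Mathlib
  (OUTLINE D2, review 10): no instance is faked.
* `serreWeight p ρ̄ loc ι : ℕ`, the global weight `k(ρ̄)`; API (named facts `def X : Prop`,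
  cited) `isSerreWeight_serreWeightLocal` (derived from the existence of an inertia shape,
  Serre §2.1, Prop. 1, by the conditional theorem `isSerreWeight_serreWeightLocal_of`),
  `two_le_serreWeightLocal`, `serreWeightLocal_le` (`≤ q² - 1`, `q ≠ 2`),
  `serreWeightLocal_le_four` (`q = 2`), `serreWeight_le`, `IsSerreWeight.unique`; the global
  facts follow from the local ones by the conditional theorems `isSerreWeight_serreWeight_of_local`,
  `serreWeight_le_of_local`, `serreWeight_le_four_of_local`.

## Mathlib search

Mathlib has no Serre weight, no peu/très ramifié predicates, no fundamental characters
(grep `[Ss]erre.?[Ww]eight`, `[Pp]euRamif`, `[Tt]resRamif`, `fundamental.*haracter`: no hits).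
Reused: `IsNonarchimedeanLocalField`, `Valuation.integer` (`𝒪[F]`), `Irreducible` (uniformisers,
Mathlib's `IsDiscreteValuationRing` convention), `Nat.sInf_mem`.

## Design choices

* **Residue embedding explicit, uniformiser existential.**  As in item C15 (OUTLINE §4.9) the
  residue embedding `ι : S ⧸ 𝔓 →+* k` is an explicit argument of every local definition (it
  exists as soon as `k ⊇ 𝔽̄_p`; changing `ι` by a Frobenius power permutes the level-two
  exponents `(a, b)`, which the normalisation `a < b` absorbs, Serre §2.2).  The uniformiser
  `ϖ` entering the fundamental characters is quantified existentially inside the predicates: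
  by `fundamentalCharacter_eq` (C15) the shapes do not depend on it, so `∃ ϖ` and `∀ ϖ` agree.
* **`q` versus `p`.**  Locally everything is written with `q = residueFieldCard F`; the global
  wrapper imposes `q = p` (`LocalRestrictionAt.residueFieldCard_eq`).  Bounds on exponents
  are written additively (`b + 1 ≤ q`, `b + 2 ≤ q`) to avoid `ℕ`-subtraction; the très
  ramifiée value is written as Serre's product `(α + 1)(q + 1)` (`= 1 + qa + b + q - 1`), with
  his convention `k = 4` for `q = 2`.
* **Peu/très ramifiée.**  Serre (§2.4 (ii)) defines these only in the wild level-one case with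
  `β = α + 1` via Kummer theory (`K = K_t(x_1^{1/p}, …)`, peu ⇔ all `x_i` may be taken units of
  `ℚ_p^{nr}`).  We define them for every `ρ̄_F` by the upper numbering; a tamely ramified
  `ρ̄_F` is peu ramifiée (`IsTamelyRamified.isPeuRamifie`), a très ramifiée one is wild
  (`IsTresRamifie.not_isTamelyRamified`), and the equivalence with Serre's Kummer condition in
  his setting is the (sorried) content of the theory of conductors of Kummer extensions
  (Serre, *Local Fields*, Ch. IV §3–4, Ch. XV §2 exercises).
* **`serreWeightLocal` by cases + `sInf`.**  The case split (level two / tame / wild) is a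
  classical `if`; inside each case the exponents are only determined up to the normalisations
  Serre allows, and we take `sInf` of the resulting set of weights (a singleton in Serre's
  setting; Serre's `min` in (2.3.2)).  `IsSerreWeight` is kept alongside as the
  characterising predicate; `isSerreWeight_serreWeightLocal` links them.
* `LocalRestrictionAt` is a `structure` carrying a type and instances (made global instances by
  `attribute [instance]`); the local field `F : Type` (as `ℚ_[p]` is), so the structure lives in
  `Type (max 1 v)` for `k : Type v`.  Besides the outline's fields it records that `p` is a
  uniformiser (`irreducible_natCast`), pinning `F ≅ ℚ_p` rather than a ramified extension.
  Nothing is added to Mathlib namespaces.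

## References

* J.-P. Serre, *Sur les représentations modulaires de degré 2 de `Gal(ℚ̄/ℚ)`*, Duke Math. J.
  54 (1987), §2.1 (Prop. 1: shape of `ρ_p|I`), §2.2 (level 2: `k = 1 + pa + b`), §2.3 (level 1
  tame, (2.3.1)–(2.3.2)), §2.4 (level 1 wild, (i) `β ≠ α + 1`, (ii) `β = α + 1`, peu/très
  ramifiée), §2.5–2.7 (remarks, examples).
* B. Edixhoven, *The weight in Serre's conjectures on modular forms*, Invent. Math. 109 (1992),
  §2 (level and shapes), §4 (the refinement `k = 1` in the unramified case — not used here).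
* J.-P. Serre, *Local Fields*, Ch. IV §3 (upper numbering).
-/

noncomputable section

open scoped Valued
open Field ValuativeRel

namespace Literature.NumberTheory.GaloisRepresentations

universe u v

open GaloisRepresentations.IsNonarchimedeanLocalField

namespace ModPGaloisRep

/-! ### Peu and très ramifiée representations -/

section Local

variable {F : Type u} [Field F] [ValuativeRel F] [TopologicalSpace F] [IsNonarchimedeanLocalField F]
variable {k : Type v} [Field k] [TopologicalSpace k] {n : ℕ}

/-- `ρ̄_F` is **peu ramifiée**: every upper-numbering ramification group `I_F^v` with `v > 1`
acts trivially.  In Serre's setting (`F = ℚ_p`, `ρ̄|I = (χ^{α+1} *; 0 χ^α)` with wild inertia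
acting non-trivially) this is equivalent to Serre's definition: the wild part of the splitting
field is `K_t(x_1^{1/p}, …, x_m^{1/p})` with all `x_i` units of `ℚ_p^{nr}` (equivalently the
extension class is finite flat), because a Kummer extension `ℚ_p^{nr}(ζ_p, x^{1/p})` has upper
ramification jump `≤ 1` iff `p ∣ v(x)`, and jump `1 + 1/(p-1)` otherwise.  A tamely ramified
representation is peu ramifiée (`IsTamelyRamified.isPeuRamifie`).
Ref: Serre, Duke Math. J. 54 (1987), §2.4 (ii) ("peu ramifiée"); Serre, *Local Fields*,
Ch. IV §3; Edixhoven, Invent. Math. 109 (1992), §2. [folklore] -/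
def IsPeuRamifie (ρ : ModPGaloisRep F k n) : Prop :=
  ∀ v : ℝ, 1 < v → ∀ σ ∈ absUpperInertia F v, ρ σ = 1

/-- `ρ̄_F` is **très ramifiée**: some upper-numbering ramification group `I_F^v` with `v > 1`
acts non-trivially (in Serre's setting: the upper jump of the wild Kummer extension is
`1 + 1/(p-1)`, i.e. some Kummer generator `x_i` has `p ∤ v(x_i)`).  This is the negation of
`IsPeuRamifie` (`isTresRamifie_iff_not_isPeuRamifie`) and forces wild ramification
(`IsTresRamifie.not_isTamelyRamified`).
Ref: Serre, Duke Math. J. 54 (1987), §2.4 (ii) ("très ramifiée"); Serre, *Local Fields*,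
Ch. IV §3. [folklore] -/
def IsTresRamifie (ρ : ModPGaloisRep F k n) : Prop :=
  ∃ v : ℝ, 1 < v ∧ ∃ σ ∈ absUpperInertia F v, ρ σ ≠ 1

/-- Très ramifiée is the negation of peu ramifiée.
Ref: Serre, Duke Math. J. 54 (1987), §2.4 (ii). [folklore] -/
theorem isTresRamifie_iff_not_isPeuRamifie (ρ : ModPGaloisRep F k n) :
    ρ.IsTresRamifie ↔ ¬ ρ.IsPeuRamifie := by
  simp only [IsTresRamifie, IsPeuRamifie, not_forall, exists_prop, ne_eq]

/-- A tamely ramified representation (all `I_F^v`, `v > 0`, act trivially) is peu ramifiée.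
Ref: Serre, Duke Math. J. 54 (1987), §2.3–2.4. [folklore] -/
theorem IsTamelyRamified.isPeuRamifie {ρ : ModPGaloisRep F k n} (h : ρ.IsTamelyRamified) :
    ρ.IsPeuRamifie :=
  fun v hv σ hσ => h v (one_pos.trans hv) σ hσ

/-- A très ramifiée representation is wildly ramified.
Ref: Serre, Duke Math. J. 54 (1987), §2.4 (ii). [folklore] -/
theorem IsTresRamifie.not_isTamelyRamified {ρ : ModPGaloisRep F k n} (h : ρ.IsTresRamifie) :
    ¬ ρ.IsTamelyRamified :=
  fun ht => (ρ.isTresRamifie_iff_not_isPeuRamifie.mp h) ht.isPeuRamifie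

/-! ### The three cases of Serre's recipe -/

variable (ρ : ModPGaloisRep F k 2) (ι : absIntegers 𝒪[F] F ⧸ absMaximalIdeal F →+* k)

/-- **Level-two case** of Serre's recipe: `m` is a level-two weight of `ρ̄_F` if, for some
normalised exponents `0 ≤ a < b ≤ q - 1`, `ρ̄|I_F ≃ diag(ψ^{a + q b}, ψ^{q a + b})`
(`HasLevelTwoInertiaShape`, `ψ` the level-two fundamental character w.r.t. some — equivalently
any, `fundamentalCharacter_eq` — uniformiser `ϖ`) and `m = 1 + q a + b`.  (`a ≠ b` exactly
excludes characters of level one.)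
Ref: Serre, Duke Math. J. 54 (1987), §2.2 ("on pose `k = 1 + pa + b`"). [folklore] -/
def IsLevelTwoWeight (m : ℕ) : Prop :=
  ∃ a b : ℕ, a < b ∧ b + 1 ≤ residueFieldCard F ∧
    (∃ (ϖ : 𝒪[F]) (hϖ : Irreducible ϖ), ρ.HasLevelTwoInertiaShape ι ϖ hϖ a b) ∧
    m = 1 + residueFieldCard F * a + b

/-- **Level-one tame case** of Serre's recipe: `ρ̄_F` is tamely ramified,
`ρ̄|I_F ≃ diag(χ^a, χ^b)` (`HasLevelOneInertiaShape` with `χ = ψ_1`) for normalised exponents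
`0 ≤ a ≤ b ≤ q - 2`, and `m = 1 + q a + b` if `(a, b) ≠ (0, 0)`, `m = q` if `(a, b) = (0, 0)`.
The ordering `a ≤ b` realises Serre's `min(1 + pa + b, 1 + pb + a)`.
Ref: Serre, Duke Math. J. 54 (1987), §2.3, (2.3.1)–(2.3.2). [folklore] -/
def IsLevelOneTameWeight (m : ℕ) : Prop :=
  ρ.IsTamelyRamified ∧ ∃ a b : ℕ, a ≤ b ∧ b + 2 ≤ residueFieldCard F ∧
    (∃ (ϖ : 𝒪[F]) (hϖ : Irreducible ϖ), ρ.HasLevelOneInertiaShape ι ϖ hϖ a b) ∧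
    m = if a = 0 ∧ b = 0 then residueFieldCard F else 1 + residueFieldCard F * a + b

open scoped Classical in
/-- **Level-one wild case** of Serre's recipe: wild inertia acts non-trivially,
`ρ̄|I_F ≃ (χ^β *; 0 χ^α)` (`HasLevelOneInertiaShape ι ϖ hϖ β α`) with the exponents normalised
as `0 ≤ α ≤ q - 2`, `1 ≤ β ≤ q - 1` (they are then unique), `a = min(α, β)`, `b = max(α, β)`,
and
* (i) if `β ≠ α + 1`: `m = 1 + q a + b`;
* (ii) if `β = α + 1`: `m = 1 + q a + b = 2 + α(q+1)` when `ρ̄_F` is peu ramifiée (ii₁), and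
  `m = 1 + q a + b + (q - 1) = (α + 1)(q + 1)` when `ρ̄_F` is très ramifiée and `q ≠ 2`,
  `m = 4` when `ρ̄_F` is très ramifiée and `q = 2` (ii₂).
The case distinction is a classical `if` (peu/très ramifiée is not decidable).
Ref: Serre, Duke Math. J. 54 (1987), §2.4, cases (i), (ii₁), (ii₂) (including the convention
`k = 4` for `p = 2` très ramifiée); Edixhoven, Invent. Math. 109 (1992), Def. 4.3. [folklore] -/
def IsLevelOneWildWeight (m : ℕ) : Prop :=
  ¬ ρ.IsTamelyRamified ∧ ∃ α β : ℕ, α + 2 ≤ residueFieldCard F ∧ 1 ≤ β ∧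
    β + 1 ≤ residueFieldCard F ∧
    (∃ (ϖ : 𝒪[F]) (hϖ : Irreducible ϖ), ρ.HasLevelOneInertiaShape ι ϖ hϖ β α) ∧
    m = if β = α + 1 ∧ ρ.IsTresRamifie then
          (if residueFieldCard F = 2 then 4 else (α + 1) * (residueFieldCard F + 1))
        else 1 + residueFieldCard F * min α β + max α β

/-- `m` **is a Serre weight of `ρ̄_F`**: one of the three cases of Serre's recipe
(`IsLevelTwoWeight`, `IsLevelOneTameWeight`, `IsLevelOneWildWeight`) yields `m`.  In Serre's
setting exactly one case applies and `m` is unique; `serreWeightLocal` picks it.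
Ref: Serre, Duke Math. J. 54 (1987), §2.1–2.4 (definition of `k`). [folklore] -/
def IsSerreWeight (m : ℕ) : Prop :=
  ρ.IsLevelTwoWeight ι m ∨ ρ.IsLevelOneTameWeight ι m ∨ ρ.IsLevelOneWildWeight ι m

open scoped Classical in
/-- **Serre's weight `k(ρ̄_F)`** of a two-dimensional mod `p` representation of the local field
`F`, by cases: if `ρ̄|I_F` has level two, `1 + q a + b` (`0 ≤ a < b ≤ q-1`, §2.2); else if
`ρ̄_F` is tame, `1 + q a + b` resp. `q` (`0 ≤ a ≤ b ≤ q-2`, (2.3.2)); else the wild formula of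
§2.4 with the peu/très ramifiée correction.  Within each case the value is the `sInf` over the
admissible normalised exponents (a singleton in Serre's setting, his `min` in (2.3.2)).
**Junk value** `0` when no inertia shape applies (which does not happen for `k ⊇ 𝔽̄_p`,
`isSerreWeight_serreWeightLocal`).
Ref: Serre, Duke Math. J. 54 (1987), §2.2–2.4; Edixhoven, Invent. Math. 109 (1992), §4.3.
[folklore] -/
def serreWeightLocal : ℕ :=
  if ∃ m, ρ.IsLevelTwoWeight ι m then sInf {m | ρ.IsLevelTwoWeight ι m}
  else if ρ.IsTamelyRamified then sInf {m | ρ.IsLevelOneTameWeight ι m}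
  else sInf {m | ρ.IsLevelOneWildWeight ι m}

variable {ρ ι}

/-- A level-two weight is a Serre weight. [folklore] -/
theorem IsLevelTwoWeight.isSerreWeight {m : ℕ} (h : ρ.IsLevelTwoWeight ι m) :
    ρ.IsSerreWeight ι m :=
  Or.inl h

/-- A level-one tame weight is a Serre weight. [folklore] -/
theorem IsLevelOneTameWeight.isSerreWeight {m : ℕ} (h : ρ.IsLevelOneTameWeight ι m) :
    ρ.IsSerreWeight ι m :=
  Or.inr (Or.inl h)

/-- A level-one wild weight is a Serre weight. [folklore] -/
theorem IsLevelOneWildWeight.isSerreWeight {m : ℕ} (h : ρ.IsLevelOneWildWeight ι m) :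
    ρ.IsSerreWeight ι m :=
  Or.inr (Or.inr h)

/-- In the level-two case `ρ̄_F` is tamely ramified (C15,
`HasLevelTwoInertiaShape.isTamelyRamified`).  Ref: Serre, Duke Math. J. 54 (1987), §2.2.
[cite: Serre1987, §2.2] -/
def IsLevelTwoWeight.isTamelyRamified : Prop :=
  ∀ {m : ℕ} (_h : ρ.IsLevelTwoWeight ι m),
    ρ.IsTamelyRamified

/-- `IsLevelTwoWeight.isTamelyRamified` follows from the named fact
`HasLevelTwoInertiaShape.isTamelyRamified` (item C15). [cite: Serre1987, §2.2] -/
theorem IsLevelTwoWeight.isTamelyRamified_of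
    (H : HasLevelTwoInertiaShape.isTamelyRamified (F := F) (k := k)) :
    IsLevelTwoWeight.isTamelyRamified (ρ := ρ) (ι := ι) := by
  intro m h
  obtain ⟨_, _, _, _, ⟨_, _, hs⟩, _⟩ := h
  exact H hs

variable (ρ ι)

/-- **Structure of `ρ̄|I_F`** (existence part of Serre's recipe): for a continuous
`ρ̄_F : Γ_F → GL₂(k)` with `k` discrete (finite image) and a residue embedding `ι`, one of the
three cases applies, i.e. some `m` is a Serre weight.  (The semisimplification of `ρ̄|I` is
`φ ⊕ φ'` with `φ, φ'` both of level one or conjugate of level two.)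
Ref: Serre, Duke Math. J. 54 (1987), §2.1, Prop. 1 and §2.2–2.4.
[cite: Serre1987, §2.1 Prop. 1; §2.2–2.4] -/
def exists_isSerreWeight : Prop :=
  ∀ [DiscreteTopology k],
    ∃ m, ρ.IsSerreWeight ι m

/-- **Uniqueness**: in Serre's setting the weight is well defined — two Serre weights of the
same `ρ̄_F` coincide (the level, the normalised exponents and the peu/très alternative are
determined by `ρ̄|I_F`; needs `ι` injective, automatic once `S ⧸ 𝔓` is known to be a field).
Ref: Serre, Duke Math. J. 54 (1987), §2.1 (unicity of `φ, φ'`), §2.4 ("`α, β` sont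
uniques"). [cite: Serre1987, §2.1 and §2.4 (unicité de α β)] -/
def IsSerreWeight.unique : Prop :=
  ∀ [DiscreteTopology k] (_hι : Function.Injective ι) {m m' : ℕ} (_h : ρ.IsSerreWeight ι m)
    (_h' : ρ.IsSerreWeight ι m'),
    m = m'

/-- `serreWeightLocal` satisfies Serre's recipe (for `k` discrete, so that an inertia shape
exists, `exists_isSerreWeight`).  Ref: Serre, Duke Math. J. 54 (1987), §2.2–2.4.
[cite: Serre1987, §2.2–2.4] -/
def isSerreWeight_serreWeightLocal : Prop :=
  ∀ [DiscreteTopology k],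
    ρ.IsSerreWeight ι (ρ.serreWeightLocal ι)

/-- `isSerreWeight_serreWeightLocal` follows from the existence of an inertia shape
(the named fact `exists_isSerreWeight`) by `Nat.sInf_mem` in each case.
[cite: Serre1987, §2.2–2.4] -/
theorem isSerreWeight_serreWeightLocal_of (H : ρ.exists_isSerreWeight ι) :
    ρ.isSerreWeight_serreWeightLocal ι := by
  intro _
  obtain ⟨m, hm⟩ := H
  unfold serreWeightLocal
  split_ifs with h₂ ht
  · exact IsLevelTwoWeight.isSerreWeight (Nat.sInf_mem h₂)
  · rcases hm with hm | hm | hm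
    · exact (h₂ ⟨m, hm⟩).elim
    · exact IsLevelOneTameWeight.isSerreWeight
        (Nat.sInf_mem (⟨m, hm⟩ : ∃ m, ρ.IsLevelOneTameWeight ι m))
    · exact (hm.1 ht).elim
  · rcases hm with hm | hm | hm
    · exact (h₂ ⟨m, hm⟩).elim
    · exact (ht hm.1).elim
    · exact IsLevelOneWildWeight.isSerreWeight
        (Nat.sInf_mem (⟨m, hm⟩ : ∃ m, ρ.IsLevelOneWildWeight ι m))

/-- **Lower bound** `2 ≤ k(ρ̄_F)` (level two: `a = 0, b = 1` is minimal; tame: `q ≥ 2` or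
`1 + qa + b ≥ 2` for `(a, b) ≠ (0, 0)`; wild: `β ≥ 1`).
Ref: Serre, Duke Math. J. 54 (1987), §2, Remarque after (2.4) (`2 ≤ k ≤ p² - 1`).
[cite: Serre1987, §2.4 Remarque (2 ≤ k ≤ p²-1)] -/
def two_le_serreWeightLocal : Prop :=
  ∀ [DiscreteTopology k],
    2 ≤ ρ.serreWeightLocal ι

/-- **Upper bound** `k(ρ̄_F) ≤ q² - 1` for `q ≠ 2` (attained only in the très ramifiée case
`α = q - 2`, `β = q - 1`).
Ref: Serre, Duke Math. J. 54 (1987), §2.4, Remarque (`2 ≤ k ≤ p² - 1` si `p ≠ 2`).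
[cite: Serre1987, §2.4 Remarque (k ≤ p²-1 for p ≠ 2)] -/
def serreWeightLocal_le : Prop :=
  ∀ (_hq : residueFieldCard F ≠ 2),
    ρ.serreWeightLocal ι ≤ residueFieldCard F ^ 2 - 1

/-- **Upper bound** `k(ρ̄_F) ≤ 4` for `q = 2` (attained only in the très ramifiée case).
Ref: Serre, Duke Math. J. 54 (1987), §2.4, Remarque (`2 ≤ k ≤ 4` si `p = 2`).
[cite: Serre1987, §2.4 Remarque (k ≤ 4 for p = 2)] -/
def serreWeightLocal_le_four : Prop :=
  ∀ (_hq : residueFieldCard F = 2),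
    ρ.serreWeightLocal ι ≤ 4

/-- In the peu ramifiée wild case `ρ̄|I ≃ (χ *; 0 1)` (`α = 0`, `β = 1`) the weight is `2`.
Ref: Serre, Duke Math. J. 54 (1987), §2.4 (ii) (`k = 2` si peu ramifiée, `α = 0`); Prop. 4.
[cite: Serre1987, §2.4 (ii₁); Prop. 4] -/
def serreWeightLocal_eq_two : Prop :=
  ∀ [DiscreteTopology k] (_hι : Function.Injective ι) (_hw : ¬ ρ.IsTamelyRamified)
    (_hpeu : ρ.IsPeuRamifie) {ϖ : 𝒪[F]} (hϖ : Irreducible ϖ)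
    (_h : ρ.HasLevelOneInertiaShape ι ϖ hϖ 1 0),
    ρ.serreWeightLocal ι = 2

/-- In the très ramifiée wild case `ρ̄|I ≃ (χ *; 0 1)` (`α = 0`, `β = 1`) the weight is
`q + 1` (`q ≠ 2`).
Ref: Serre, Duke Math. J. 54 (1987), §2.4 (ii₂) (`k = p + 1` si très ramifiée).
[cite: Serre1987, §2.4 (ii₂)] -/
def serreWeightLocal_eq_residueFieldCard_add_one : Prop :=
  ∀ [DiscreteTopology k] (_hι : Function.Injective ι) (_hq : residueFieldCard F ≠ 2)
    (_htres : ρ.IsTresRamifie) {ϖ : 𝒪[F]} (hϖ : Irreducible ϖ)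
    (_h : ρ.HasLevelOneInertiaShape ι ϖ hϖ 1 0),
    ρ.serreWeightLocal ι = residueFieldCard F + 1

end Local

/-! ### The global weight `k(ρ̄)` for `ρ̄ : Γ_ℚ → GL₂(k)` -/

section Global

variable {k : Type v} [Field k] [TopologicalSpace k]

/-- A **local restriction datum at `p`** for a global mod `p` representation
`ρ̄ : Γ_ℚ → GL₂(k)`: an abstract non-archimedean local field `F` over `ℚ` playing the role of
`ℚ_p` — its residue field has `p` elements and `p` is a uniformiser of `𝒪[F]` (so `F/ℚ_p` is
unramified of residue degree one, i.e. `F ≅ ℚ_p`) — together with the local representation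
`rep : Γ_F → GL₂(k)` and the proof that it *is* the restriction of `ρ̄` along the fixed map
`absGaloisRestrict ℚ F : Γ_F →ₜ* Γ_ℚ` (`FramedGaloisRep.restrictField`, item C6/C2).
This structure replaces the instances `ValuativeRel (v.adicCompletion ℚ)`,
`IsNonarchimedeanLocalField (v.adicCompletion ℚ)` / `IsNonarchimedeanLocalField ℚ_[p]` that
Mathlib does not have (OUTLINE D2, D4, review 10): a user instantiates it with `F = ℚ_[p]` once
`Padic.isNonarchimedeanLocalField` (item C1) is available as an instance.
Ref: Serre, Duke Math. J. 54 (1987), §2.1 ("`G_p = Gal(ℚ̄_p/ℚ_p)` … choix d'une place de `ℚ̄`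
prolongeant `p`"). [folklore] -/
structure LocalRestrictionAt (p : ℕ) (ρ : ModPGaloisRep ℚ k 2) : Type (max 1 v) where
  /-- The abstract local field playing the role of `ℚ_p`. -/
  F : Type
  [instField : Field F]
  [instValuativeRel : ValuativeRel F]
  [instTopologicalSpace : TopologicalSpace F]
  [isNonarchimedeanLocalField : IsNonarchimedeanLocalField F]
  [instAlgebra : Algebra ℚ F]
  /-- The residue field of `F` is `𝔽_p`. -/
  residueFieldCard_eq : residueFieldCard F = p
  /-- `p` is a uniformiser of `𝒪[F]` (`F/ℚ_p` is unramified). -/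
  irreducible_natCast : Irreducible (p : 𝒪[F])
  /-- The local representation `ρ̄|Γ_F`. -/
  rep : ModPGaloisRep F k 2
  /-- `rep` is the restriction of `ρ̄` along `absGaloisRestrict ℚ F`. -/
  rep_eq_restrictField : rep = FramedGaloisRep.restrictField F ρ

attribute [instance] LocalRestrictionAt.instField LocalRestrictionAt.instValuativeRel
  LocalRestrictionAt.instTopologicalSpace LocalRestrictionAt.isNonarchimedeanLocalField
  LocalRestrictionAt.instAlgebra

variable (p : ℕ) (ρ : ModPGaloisRep ℚ k 2)

namespace LocalRestrictionAt

variable {p ρ} (loc : LocalRestrictionAt p ρ)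

/-- Unfolding lemma: the local representation evaluated at `σ ∈ Γ_F` is
`ρ̄ (absGaloisRestrict ℚ F σ)`. [folklore] -/
lemma rep_apply (σ : absoluteGaloisGroup loc.F) : loc.rep σ = ρ (absGaloisRestrict ℚ loc.F σ) := by
  rw [loc.rep_eq_restrictField, FramedGaloisRep.restrictField_apply]

/-- `p` is non-zero in `𝒪[F]` (it is a uniformiser). [folklore] -/
lemma natCast_ne_zero : (p : 𝒪[loc.F]) ≠ 0 :=
  loc.irreducible_natCast.ne_zero

end LocalRestrictionAt

/-- **Serre's weight `k(ρ̄)`** of a global mod `p` representation `ρ̄ : Γ_ℚ → GL₂(k)`, computed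
from its restriction to `Γ_{ℚ_p}` supplied as a local restriction datum `loc` and a residue
embedding `ι : S ⧸ 𝔓 →+* k` of the residue field of `ℚ̄_p` into `k` (explicit, OUTLINE §4.9):
`serreWeightLocal loc.rep ι`, where now `q = p`.
Ref: Serre, Duke Math. J. 54 (1987), §2 ("définition de `k`"), (3.2.4) (the conjecture uses
`(N(ρ̄), k(ρ̄), ε(ρ̄))`). [folklore] -/
def serreWeight (loc : LocalRestrictionAt p ρ)
    (ι : absIntegers 𝒪[loc.F] loc.F ⧸ absMaximalIdeal loc.F →+* k) : ℕ :=
  loc.rep.serreWeightLocal ι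

/-- `k(ρ̄)` is a Serre weight of the local restriction (for `k` discrete).
Ref: Serre, Duke Math. J. 54 (1987), §2.2–2.4. [cite: Serre1987, §2.2–2.4] -/
def isSerreWeight_serreWeight : Prop :=
  ∀ [DiscreteTopology k] (loc : LocalRestrictionAt p ρ)
    (ι : absIntegers 𝒪[loc.F] loc.F ⧸ absMaximalIdeal loc.F →+* k),
    loc.rep.IsSerreWeight ι (serreWeight p ρ loc ι)

/-- `isSerreWeight_serreWeight` is the local fact `isSerreWeight_serreWeightLocal` at the local
restriction datum (the interim proof, threaded). [folklore] -/
theorem isSerreWeight_serreWeight_of_local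
    (hloc : ∀ (loc : LocalRestrictionAt p ρ)
      (ι : absIntegers 𝒪[loc.F] loc.F ⧸ absMaximalIdeal loc.F →+* k),
      loc.rep.isSerreWeight_serreWeightLocal ι) :
    isSerreWeight_serreWeight p ρ :=
  fun loc ι => hloc loc ι

/-- **Bounds** `2 ≤ k(ρ̄) ≤ p² - 1` for `p ≠ 2` (for `p = 2`: `2 ≤ k(ρ̄) ≤ 4`,
`serreWeight_le_four`).
Ref: Serre, Duke Math. J. 54 (1987), §2.4, Remarque (`2 ≤ k ≤ p² - 1`).
[cite: Serre1987, §2.4 Remarque] -/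
def serreWeight_le : Prop :=
  ∀ [DiscreteTopology k] (_hp : p ≠ 2) (loc : LocalRestrictionAt p ρ)
    (ι : absIntegers 𝒪[loc.F] loc.F ⧸ absMaximalIdeal loc.F →+* k),
    2 ≤ serreWeight p ρ loc ι ∧ serreWeight p ρ loc ι ≤ p ^ 2 - 1

/-- `serreWeight_le` follows from the local bounds `two_le_serreWeightLocal` and
`serreWeightLocal_le` at the local restriction datum, using `q = p`
(`LocalRestrictionAt.residueFieldCard_eq`; the interim proof, threaded). [folklore] -/
theorem serreWeight_le_of_local
    (h2 : ∀ (loc : LocalRestrictionAt p ρ)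
      (ι : absIntegers 𝒪[loc.F] loc.F ⧸ absMaximalIdeal loc.F →+* k),
      loc.rep.two_le_serreWeightLocal ι)
    (hle : ∀ (loc : LocalRestrictionAt p ρ)
      (ι : absIntegers 𝒪[loc.F] loc.F ⧸ absMaximalIdeal loc.F →+* k),
      loc.rep.serreWeightLocal_le ι) :
    serreWeight_le p ρ := by
  intro _ hp loc ι
  refine ⟨h2 loc ι, ?_⟩
  have h := hle loc ι (loc.residueFieldCard_eq.symm ▸ hp)
  rw [loc.residueFieldCard_eq] at h
  exact h

/-- **Bounds** `2 ≤ k(ρ̄) ≤ 4` for `p = 2`.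
Ref: Serre, Duke Math. J. 54 (1987), §2.4, Remarque (`2 ≤ k ≤ 4` si `p = 2`).
[cite: Serre1987, §2.4 Remarque] -/
def serreWeight_le_four : Prop :=
  ∀ [DiscreteTopology k] (loc : LocalRestrictionAt 2 ρ)
    (ι : absIntegers 𝒪[loc.F] loc.F ⧸ absMaximalIdeal loc.F →+* k),
    2 ≤ serreWeight 2 ρ loc ι ∧ serreWeight 2 ρ loc ι ≤ 4

/-- `serreWeight_le_four` follows from the local bounds `two_le_serreWeightLocal` and
`serreWeightLocal_le_four` at the local restriction datum (the interim proof, threaded).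
[folklore] -/
theorem serreWeight_le_four_of_local
    (h2 : ∀ (loc : LocalRestrictionAt 2 ρ)
      (ι : absIntegers 𝒪[loc.F] loc.F ⧸ absMaximalIdeal loc.F →+* k),
      loc.rep.two_le_serreWeightLocal ι)
    (h4 : ∀ (loc : LocalRestrictionAt 2 ρ)
      (ι : absIntegers 𝒪[loc.F] loc.F ⧸ absMaximalIdeal loc.F →+* k),
      loc.rep.serreWeightLocal_le_four ι) :
    serreWeight_le_four ρ :=
  fun loc ι => ⟨h2 loc ι, h4 loc ι loc.residueFieldCard_eq⟩

end Global

end ModPGaloisRep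

end Literature.NumberTheory.GaloisRepresentations
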